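import Summits.ValiantsHypothesis.ValiantsHypothesis.Theorems.KPlusLogSqLawTropicalBHalfThin
import Summits.ValiantsHypothesis.ValiantsHypothesis.Theorems.KPlusLogSqLawTropicalBIteratedHalving

/-!
# Route «KPlusLogSqLaw», crux `TropicalB` (stmt-ValiantsHypothesis-19771) — the HALF-THIN LAW IS SIGN-FREE:
# `2·(T_D(m,K) + 1) ≤ 2·m! + (m!·m + m²)·(K − 1)` and the UNSIGNED `m = 3` row `T_D(3,K) ≤ ⌊(27K − 17)/2⌋`

HONEST FRAMING.  Helper toward the crux `Summit.ValiantsHypothesis.ValiantsHypothesis.Theses.KPlusLogSqLaw.TropicalB` (ledger item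
`stmt-ValiantsHypothesis-19771`, registered stubs `stub_tropThin` / `stub_tropFat`; cell `pub-symmetroid`, seat val-sym-trop-p3 g6,
2026-08-27; `--supports … --as helper`).  A super-fat-corner census bound (fixed size `m`, many classes `K`), OFF the window
`⌊log₂ m⌋ + 1 < K < m` where the crux lives; nothing here bears on `TropicalB` in its window, on `WeakLifting` / `Lifting`, on the cell's real
census / DoorA26 / DoorA34, on `MatrixDescartes` (stmt-ValiantsHypothesis-18050) or on VP ≠ VNP.

OBSERVATION.  The half-thin law of val-sym-trop-p4 g4 (`RefreshExclusivity.two_mul_succ_le_card_perms`, `tropRootLawAt_halfThin`,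
`tropRootLawAt_three_halfThin`, file `…TropicalBHalfThin`) is stated for SIGN-ALTERNATING dominant chains, but its proof uses the signs at
exactly one place: `RefreshExclusivity.chain_ne` (pairwise distinctness of the chain terms), which needs only that CONSECUTIVE terms differ —
the hypothesis of the unsigned row `TropRowD` (`…TropicalBSplitDefs`).  Everything else (refresh exclusivity `card_tight_le`, change mass
`sum_card_chg_le`) is sign-free already.  Hence:

* `chain_ne_of_succ_ne` — an UNSIGNED dominant chain (consecutive terms distinct) has pairwise distinct terms (same three-point affine
  argument as `chain_ne`);
* `two_mul_succ_le_card_perms_of_succ_ne` — `2(n+1) ≤ (2 + m(K−1))·|Π| + m²(K−1)` for unsigned dominant chains (proof = p4 g4's, verbatim,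
  with `chain_ne` replaced; adapted, not restated: the signed theorem is the special case `halt ⇒ succ_ne`);
* `tropRowD_halfThin (m K) : TropRowD m K (m! − 1 + ⌊(m!·m + m²)(K−1)/2⌋)` — the UNSIGNED HALF-THIN LAW, all formats;
* `tropRowD_three_halfThin (K) : TropRowD 3 K (5 + ⌊27(K−1)/2⌋)` — the UNSIGNED `m = 3` ROW `T_D(3,K) ≤ ⌊(27K−17)/2⌋`: below the iterated-halving
  row `T_D(3,K) ≤ 15K − 10` of val-sym-trop-p4 g6 (`IteratedHalving.tropRowD_three_row`, p505865) from `K = 3` on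
  (`three_halfThinD_lt_three_row`), so the unsigned `m = 3` row of record becomes `10K − 41 ≤ T_D(3,K) ≤ ⌊(27K−17)/2⌋`
  (floor: `ThreeRowTenFamily.not_tropRowD`, p495608), slope `c₃ᴰ := limsup T_D(3,K)/K ∈ [10, 13.5]` (was `[10, 15]`);
* `tropRowD_three_record (K) : TropRowD 3 K (min (15K − 10) (5 + 27(K−1)/2))` — both rows in one line for citation.
For `m ≥ 4` the iterated-halving law `4^(m−1)·K − 1` (`tropRowD_four_pow`) is smaller than the half-thin bound (`48 < 56`, `190 < 312.5`
per class at `m = 4, 5`), so the new row matters at `m = 3` only (`four_pow_le_halfThinD_four`).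
[this cell; the counting argument is val-sym-trop-p4 g4's]
-/

-- `Summit.ValiantsHypothesis.ValiantsHypothesis.…` repeats a component by the D-0017 layout
-- (single-conjunct summit), which the `dupNamespace` linter flags; the name is mandated.
set_option linter.dupNamespace false
set_option autoImplicit false

namespace Summit.ValiantsHypothesis.ValiantsHypothesis.Theorems.KPlusLogSqLaw

open Summit.ValiantsHypothesis.ValiantsHypothesis.Theorems.MatrixDescartes.Negative
open Summit.ValiantsHypothesis.ValiantsHypothesis.Theorems.LacunarySymmetroidMatrixDescartes.TropicalCensus
open Finset

namespace RefreshExclusivity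

section Chain

variable {m K n : ℕ} (d : Fin K → ℕ) (v ε : Fin m → Fin m → Fin K → ℤ) (θ : Fin (n + 1) → ℤ)
  (p : Fin (n + 1) → Equiv.Perm (Fin m) × (Fin m → Fin K))

/-- The terms of an UNSIGNED dominant chain (consecutive terms distinct) are pairwise distinct: a term dominant at `θ_i` and `θ_k`
beats the (different) term at `θ_{i+1}` at both ends of `[θ_i, θ_k]`, while that term beats it at `θ_{i+1}` — impossible for an
affine weight difference. [folklore; the argument of `chain_ne`] -/
theorem chain_ne_of_succ_ne (hθ : StrictMono θ) (hdom : ∀ k, IsDominant d v ε (θ k) (p k))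
    (hsucc : ∀ k : Fin n, p k.castSucc ≠ p k.succ)
    {i k : Fin (n + 1)} (hik : i < k) : p i ≠ p k := by
  intro heq
  have hkn : (k : ℕ) ≤ n := Nat.lt_succ_iff.mp k.isLt
  have hik' : (i : ℕ) < k := hik
  let j : Fin (n + 1) := ⟨(i : ℕ) + 1, by omega⟩
  have hij : i < j := by
    change (i : ℕ) < (i : ℕ) + 1
    omega
  have hjk : j ≤ k := by
    change (i : ℕ) + 1 ≤ (k : ℕ)
    omega
  -- consecutive terms differ
  have hne : p i ≠ p j := by
    have h' := hsucc ⟨(i : ℕ), by omega⟩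
    have e1 : (⟨(i : ℕ), by omega⟩ : Fin n).castSucc = i := Fin.ext rfl
    have e2 : (⟨(i : ℕ), by omega⟩ : Fin n).succ = j := Fin.ext rfl
    rwa [e1, e2] at h'
  rcases hjk.eq_or_lt with hjk' | hjk'
  · exact hne (heq.trans (by rw [hjk']))
  · have g1 := (hdom i).2 (p j) (Ne.symm hne) (hdom j).1
    have g2 := (hdom j).2 (p i) hne (hdom i).1
    have g3 := (hdom k).2 (p j) (by rw [← heq]; exact Ne.symm hne) (hdom j).1
    rw [← heq] at g3
    unfold tropWeight at g1 g2 g3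
    have t1 := hθ hij
    have t2 := hθ hjk'
    have q1 : 0 < (θ j - θ i) * ((∑ x, (d ((p j).2 x) : ℤ)) - ∑ x, (d ((p i).2 x) : ℤ)) := by nlinarith
    have q2 : (θ k - θ j) * ((∑ x, (d ((p j).2 x) : ℤ)) - ∑ x, (d ((p i).2 x) : ℤ)) < 0 := by nlinarith
    have hA : 0 < (∑ x, (d ((p j).2 x) : ℤ)) - ∑ x, (d ((p i).2 x) : ℤ) :=
      (mul_pos_iff_of_pos_left (sub_pos.mpr t1)).mp q1
    nlinarith [mul_pos (sub_pos.mpr t2) hA]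

/-- **HALF-THIN LAW, permutation-count form, UNSIGNED.**  A dominant chain of `n + 1` terms with consecutive terms distinct, using the set
`Π` of permutations, satisfies `2(n+1) ≤ (2 + m(K−1))·|Π| + m²(K−1)`.  The proof is val-sym-trop-p4 g4's `two_mul_succ_le_card_perms`
verbatim, with `chain_ne` (the only place where sign alternation entered) replaced by `chain_ne_of_succ_ne`. [this cell; argument of p4 g4] -/
theorem two_mul_succ_le_card_perms_of_succ_ne (hθ : StrictMono θ) (hdom : ∀ k, IsDominant d v ε (θ k) (p k))
    (hsucc : ∀ k : Fin n, p k.castSucc ≠ p k.succ) :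
    2 * (n + 1) ≤ (2 + m * (K - 1)) * (univ.image fun k => (p k).1).card + m ^ 2 * (K - 1) := by
  classical
  -- steps: consecutive uses of a permutation
  set St : Finset (Fin (n + 1) × Fin (n + 1)) := univ.filter fun ik =>
      ik.1 < ik.2 ∧ (p ik.1).1 = (p ik.2).1 ∧ ∀ j, ik.1 < j → j < ik.2 → (p j).1 ≠ (p ik.2).1 with hSt
  have hStmem : ∀ ik, ik ∈ St ↔
      ik.1 < ik.2 ∧ (p ik.1).1 = (p ik.2).1 ∧ ∀ j, ik.1 < j → j < ik.2 → (p j).1 ≠ (p ik.2).1 := by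
    intro ik
    rw [hSt, Finset.mem_filter]
    exact ⟨fun h => h.2, fun h => ⟨mem_univ _, h⟩⟩
  -- first uses
  set NP : Finset (Fin (n + 1)) := univ.filter fun k => ∀ i, i < k → (p i).1 ≠ (p k).1 with hNP
  have hNPmem : ∀ k, k ∈ NP ↔ ∀ i, i < k → (p i).1 ≠ (p k).1 := by
    intro k
    rw [hNP, Finset.mem_filter]
    exact ⟨fun h => h.2, fun h => ⟨mem_univ _, h⟩⟩
  -- (1) every position is a first use or the later endpoint of a step
  have h1 : ∀ k : Fin (n + 1), k ∈ NP ∨ ∃ i, (i, k) ∈ St := by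
    intro k
    by_cases h : ∃ i, i < k ∧ (p i).1 = (p k).1
    · right
      obtain ⟨i₀, hi₀⟩ := h
      set S : Finset (Fin (n + 1)) := univ.filter fun i => i < k ∧ (p i).1 = (p k).1 with hS
      have hSmem : ∀ i, i ∈ S ↔ i < k ∧ (p i).1 = (p k).1 := by
        intro i
        rw [hS, Finset.mem_filter]
        exact ⟨fun h => h.2, fun h => ⟨mem_univ _, h⟩⟩
      have hSne : S.Nonempty := ⟨i₀, (hSmem i₀).2 hi₀⟩
      obtain ⟨hlt, hperm⟩ := (hSmem _).1 (S.max'_mem hSne)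
      refine ⟨S.max' hSne, (hStmem _).2 ⟨hlt, hperm, fun j hj hjk heq => ?_⟩⟩
      exact absurd (S.le_max' j ((hSmem j).2 ⟨hjk, heq⟩)) (not_le.mpr hj)
    · left
      push Not at h
      exact (hNPmem k).2 h
  -- (2) `n + 1 ≤ |NP| + |St|`
  have h2 : n + 1 ≤ NP.card + St.card := by
    have hsub : (univ : Finset (Fin (n + 1))) ⊆ NP ∪ St.image Prod.snd := by
      intro k _
      rcases h1 k with h | ⟨i, hi⟩
      · exact Finset.mem_union_left _ h
      · exact Finset.mem_union_right _ (Finset.mem_image.mpr ⟨(i, k), hi, rfl⟩)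
    calc n + 1 = (univ : Finset (Fin (n + 1))).card := by rw [Finset.card_univ, Fintype.card_fin]
      _ ≤ (NP ∪ St.image Prod.snd).card := Finset.card_le_card hsub
      _ ≤ NP.card + (St.image Prod.snd).card := Finset.card_union_le _ _
      _ ≤ NP.card + St.card := Nat.add_le_add_left Finset.card_image_le _
  -- (3) first uses are at most the distinct permutations
  have h3 : NP.card ≤ (univ.image fun k => (p k).1).card := by
    refine Finset.card_le_card_of_injOn (fun k => (p k).1)
      (fun k _ => Finset.mem_image.mpr ⟨k, mem_univ _, rfl⟩) ?_
    intro k hk k' hk' hkk'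
    by_contra hne
    rcases lt_or_gt_of_ne hne with h | h
    · exact (hNPmem k').1 hk' k h hkk'
    · exact (hNPmem k).1 hk k' h (Eq.symm hkk')
  -- (4) a step changes at least one column (chain terms are pairwise distinct — the sign-free `chain_ne_of_succ_ne`)
  have h4 : ∀ ik ∈ St, 1 ≤ (univ.filter fun b => (p ik.1).2 b ≠ (p ik.2).2 b).card := by
    intro ik hik
    obtain ⟨hlt, hperm, -⟩ := (hStmem ik).1 hik
    rw [Nat.one_le_iff_ne_zero, Ne, Finset.card_eq_zero, Finset.filter_eq_empty_iff]
    intro hall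
    apply chain_ne_of_succ_ne d v ε θ p hθ hdom hsucc hlt
    exact Prod.ext hperm (funext fun b => by
      by_contra hb
      exact hall (mem_univ b) hb)
  -- (5) `2·#steps ≤ #tight + change mass`
  have h5 : 2 * St.card ≤
      (St.filter fun ik => (univ.filter fun b => (p ik.1).2 b ≠ (p ik.2).2 b).card = 1).card +
      ∑ ik ∈ St, (univ.filter fun b => (p ik.1).2 b ≠ (p ik.2).2 b).card := by
    have hTS : (St.filter fun ik => (univ.filter fun b => (p ik.1).2 b ≠ (p ik.2).2 b).card = 1).card =
        ∑ ik ∈ St, if (univ.filter fun b => (p ik.1).2 b ≠ (p ik.2).2 b).card = 1 then 1 else 0 :=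
      Finset.card_filter _ _
    have h2S : 2 * St.card = ∑ _ik ∈ St, 2 := by rw [Finset.sum_const, smul_eq_mul, mul_comm]
    rw [hTS, h2S, ← Finset.sum_add_distrib]
    refine Finset.sum_le_sum fun ik hik => ?_
    have := h4 ik hik
    split_ifs <;> omega
  -- (6) change mass, (7) tight steps (both sign-free lemmas of `…TropicalBHalfThin`)
  have h6 := sum_card_chg_le d v ε θ p hθ hdom St (fun ik hik => (hStmem ik).1 hik)
  have h7 := card_tight_le d v ε θ p hθ hdom
    (St.filter fun ik => (univ.filter fun b => (p ik.1).2 b ≠ (p ik.2).2 b).card = 1)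
    (fun ik hik => by
      obtain ⟨h, hc⟩ := Finset.mem_filter.mp hik
      obtain ⟨ha, hb, hc'⟩ := (hStmem ik).1 h
      exact ⟨ha, hb, hc', hc⟩)
  calc 2 * (n + 1) ≤ 2 * NP.card + 2 * St.card := by omega
    _ ≤ 2 * (univ.image fun k => (p k).1).card +
        (m ^ 2 * (K - 1) + (K - 1) * ((univ.image fun k => (p k).1).card * m)) := by omega
    _ = (2 + m * (K - 1)) * (univ.image fun k => (p k).1).card + m ^ 2 * (K - 1) := by ring

-- The signed permutation-count form `two_mul_succ_le_card_perms` (p4 g4) is the special case «sign alternation ⇒ consecutive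
-- terms distinct» of `two_mul_succ_le_card_perms_of_succ_ne`; it is already in the tree and is not restated here.

end Chain

/-! ## The unsigned census rows -/

/-- **UNSIGNED HALF-THIN LAW** (all formats): `T_D(m,K) ≤ m! − 1 + ⌊(m!·m + m²)(K−1)/2⌋`, i.e. `2(T_D(m,K)+1) ≤ 2·m! + (m!·m + m²)(K−1)`,
for dominant chains with consecutive terms distinct and NO sign condition.  A super-fat-corner bound; off the window of the crux.
[this cell; argument of val-sym-trop-p4 g4] -/
theorem tropRowD_halfThin (m K : ℕ) :
    TropRowD m K (m.factorial - 1 + (m.factorial * m + m ^ 2) * (K - 1) / 2) := by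
  intro d v ε n θ p hθ hdom hsucc
  classical
  have h := two_mul_succ_le_card_perms_of_succ_ne d v ε θ p hθ hdom hsucc
  have hPi : (univ.image fun k => (p k).1).card ≤ m.factorial :=
    (Finset.card_le_univ _).trans (le_of_eq (by rw [Fintype.card_perm, Fintype.card_fin]))
  have h2 : 2 * (n + 1) ≤ 2 * m.factorial + (m.factorial * m + m ^ 2) * (K - 1) := by
    calc 2 * (n + 1) ≤ (2 + m * (K - 1)) * (univ.image fun k => (p k).1).card + m ^ 2 * (K - 1) := h
      _ ≤ (2 + m * (K - 1)) * m.factorial + m ^ 2 * (K - 1) :=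
          Nat.add_le_add_right (Nat.mul_le_mul_left _ hPi) _
      _ = 2 * m.factorial + (m.factorial * m + m ^ 2) * (K - 1) := by ring
  have hf : 1 ≤ m.factorial := m.factorial_pos
  omega

/-- **The UNSIGNED `m = 3` row:** `T_D(3,K) ≤ 5 + ⌊27(K−1)/2⌋ = ⌊(27K − 17)/2⌋` — the same ceiling as the signed row
`tropRootLawAt_three_halfThin`, now for chains with no sign condition. [this cell] -/
theorem tropRowD_three_halfThin (K : ℕ) : TropRowD 3 K (5 + 27 * (K - 1) / 2) := by
  refine tropRowD_mono (le_of_eq ?_) (tropRowD_halfThin 3 K)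
  have h3 : (3 : ℕ).factorial = 6 := rfl
  rw [h3]
  omega

/-- Arithmetic remark: from `K = 2` on the unsigned half-thin `m = 3` row is strictly below the iterated-halving row `15K − 10`
(`IteratedHalving.tropRowD_three_row`, p505865): `18 < 20` at `K = 2`, and the gap grows by `3` every two classes. -/
theorem three_halfThinD_lt_three_row {K : ℕ} (hK : 2 ≤ K) : 5 + 27 * (K - 1) / 2 < 15 * K - 10 := by
  omega

/-- **Unsigned `m = 3` row of record** (both ceilings in one line): `T_D(3,K) ≤ min (15K − 10) (5 + ⌊27(K−1)/2⌋)`. [this cell] -/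
theorem tropRowD_three_record (K : ℕ) : TropRowD 3 K (min (15 * K - 10) (5 + 27 * (K - 1) / 2)) := by
  rcases le_total (15 * K - 10) (5 + 27 * (K - 1) / 2) with h | h
  · rw [min_eq_left h]; exact IteratedHalving.tropRowD_three_row K
  · rw [min_eq_right h]; exact tropRowD_three_halfThin K

/-- Arithmetic remark: at `m = 4` the iterated-halving law (`48K − 31`, `IteratedHalving.tropRowD_four_row`) is already below the unsigned
half-thin bound `23 + 56(K−1)` for every `K ≥ 1`, so the half-thin row is the row of record at `m = 3` only. -/
theorem four_row_le_halfThinD_four (K : ℕ) (hK : 1 ≤ K) :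
    48 * K - 31 ≤ (4 : ℕ).factorial - 1 + ((4 : ℕ).factorial * 4 + 4 ^ 2) * (K - 1) / 2 := by
  have h4 : (4 : ℕ).factorial = 24 := rfl
  rw [h4]
  omega

end RefreshExclusivity

end Summit.ValiantsHypothesis.ValiantsHypothesis.Theorems.KPlusLogSqLaw
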